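import Summits.MatrixMultiplication.MatrixMultiplication.Theorems.SnLevelDesigns.Negative.DeadCorners
import Summits.MatrixMultiplication.MatrixMultiplication.Theorems.SnLevelDesigns.Negative.DimensionWalls

/-!
# `SnLevelDesigns` (crux stmt-MatrixMultiplication-7613, route `LevelGradedCohnUmans`):
# the `(ℤ/2)^{k+1}`-coset obstruction (negative-side support, refuter cdisprove seat)

Sorry-free.  `exists_coset_point_not_mem_quot`: if `X, Y, Z ⊆ 𝔖ₙ` are `k`-token separated
(`Sep n k X Y Z`, the crux's clause) and `K = ⟨swap (a i) (b i) : i = 0..k⟩` is generated by `k+1`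
transpositions with pairwise disjoint supports, then through every target point `x₀⁻¹ z₀`
(`x₀ ∈ X`, `z₀ ∈ Z`) the coset `x₀⁻¹ z₀ K` leaves the quotient set `Q = X⁻¹ Y Y⁻¹ Z`.
(Consequences: `X` and `Z` contain no left coset of a conjugate of `K`; `YY⁻¹ ⊉ K'` for every
conjugate `K'`.)  Engine: `sum_coset_sign_mul_tokenFn` — the signed sum of any `k`-token functional
over any coset `g₀K` vanishes (every index map `p : [k] → [n]` misses one of the `k+1` supports,
`exists_pair_disjoint_range`, and right multiplication by that transposition preserves the fibre
`{g ∘ p = q}` and the coset while flipping the sign); on `Q` the separator is `δ_{x₀⁻¹z₀}`, whose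
signed sum over the coset is `±1`.  The case `K ⊇` "everything" is `CoveringWall.lean`.
-/

namespace Summit.MatrixMultiplication.MatrixMultiplication.Theorems.SnLevelDesigns.Negative

open scoped BigOperators

noncomputable section

/-! ## The `(ℤ/2)^{k+1}`-coset obstruction (sharpest local certificate)

For `K = ⟨k+1 pairwise disjoint transpositions⟩` every `k`-token functional `f` satisfies
`∑_{κ ∈ K} sgn(g₀κ) f(g₀κ) = 0` for every `g₀` (each index map `p : [k] → [n]` misses one of the
`k+1` transposition supports — pigeonhole — and right multiplication by that transposition
preserves the fibre `{g ∘ p = q}` and the coset, flipping the sign).  Hence a `k`-token separated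
triple has, for every target `(x₀, z₀)` and every such `K`, some `κ ∈ K` with `x₀⁻¹ z₀ κ ∉ Q`:
NO COSET `gK ⊆ Q = X⁻¹YY⁻¹Z` THROUGH A POINT OF `X⁻¹Z`.  In particular (taking `y = y'`,
resp. `x = x₀`): `X` and `Z` contain no left coset of a conjugate of `K`, and `YY⁻¹ ⊉ K'` for every
conjugate `K'` (dense or "generic" sets fail this; rigid sets such as sharply `t`-transitive-like
families pass it). -/

/-- Pigeonhole: `k + 1` pairwise disjoint pairs cannot all meet a set of size `≤ k`. -/
theorem exists_pair_disjoint_range {n k : ℕ} (a b : Fin (k + 1) → Fin n)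
    (ha : Function.Injective a) (hb : Function.Injective b) (hab : ∀ i j, a i ≠ b j)
    (p : Fin k → Fin n) : ∃ i, (∀ t, p t ≠ a i) ∧ (∀ t, p t ≠ b i) := by
  classical
  by_contra hno
  push Not at hno
  set R := Finset.univ.image p with hR
  have hRcard : R.card ≤ k := by
    calc R.card ≤ (Finset.univ : Finset (Fin k)).card := Finset.card_image_le
      _ = k := by simp
  -- every `i` has a witness point of its pair inside `R`
  let w : Fin (k + 1) → Fin n := fun i => if a i ∈ R then a i else b i
  have hw : ∀ i, w i ∈ R := by
    intro i
    by_cases hai : a i ∈ R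
    · simp [w, hai]
    · simp only [w, if_neg hai]
      obtain h1 | h1 := Classical.em (∀ t, p t ≠ a i)
      · obtain ⟨t, ht⟩ := hno i h1
        exact Finset.mem_image.mpr ⟨t, Finset.mem_univ _, ht⟩
      · push Not at h1
        obtain ⟨t, ht⟩ := h1
        exact absurd (Finset.mem_image.mpr ⟨t, Finset.mem_univ _, ht⟩) hai
  have hlt : R.card < (Finset.univ : Finset (Fin (k + 1))).card := by simp; omega
  obtain ⟨i, -, j, -, hij, hwij⟩ := Finset.exists_ne_map_eq_of_card_lt_of_maps_to hlt
    (fun i _ => hw i)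
  -- the pairs are disjoint
  apply hij
  simp only [w] at hwij
  split_ifs at hwij with h1 h2 h2
  · exact ha hwij
  · exact absurd hwij (hab i j)
  · exact absurd hwij.symm (hab j i)
  · exact hb hwij

open scoped Classical in
/-- The signed sum of a `k`-token functional over any coset `g₀ K`,
`K = ⟨swap (a i) (b i) : i ≤ k⟩` with disjoint supports, vanishes. -/
theorem sum_coset_sign_mul_tokenFn {n k : ℕ} (a b : Fin (k + 1) → Fin n)
    (ha : Function.Injective a) (hb : Function.Injective b) (hab : ∀ i j, a i ≠ b j)
    (c : (Fin k → Fin n) → (Fin k → Fin n) → ℂ) (g₀ : Equiv.Perm (Fin n)) :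
    ∑ κ : Subgroup.closure (Set.range fun i => Equiv.swap (a i) (b i)),
      ((Equiv.Perm.sign (g₀ * (κ : Equiv.Perm (Fin n))) : ℤ) : ℂ) *
        tokenFn c (g₀ * (κ : Equiv.Perm (Fin n))) = 0 := by
  set K := Subgroup.closure (Set.range fun i => Equiv.swap (a i) (b i)) with hK
  unfold tokenFn
  simp_rw [Finset.mul_sum]
  rw [Finset.sum_comm]
  refine Finset.sum_eq_zero fun p _ => ?_
  obtain ⟨i, hpa, hpb⟩ := exists_pair_disjoint_range a b ha hb hab p
  have hτK : Equiv.swap (a i) (b i) ∈ K := Subgroup.subset_closure ⟨i, rfl⟩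
  set τ : K := ⟨Equiv.swap (a i) (b i), hτK⟩ with hτ
  have haibi : a i ≠ b i := hab i i
  set F : K → ℂ := fun κ => ((Equiv.Perm.sign (g₀ * (κ : Equiv.Perm (Fin n))) : ℤ) : ℂ) *
    c p (⇑(g₀ * (κ : Equiv.Perm (Fin n))) ∘ p) with hF
  have hreindex : ∑ κ, F κ = ∑ κ, F (κ * τ) :=
    (Fintype.sum_equiv (Equiv.mulRight τ) (fun κ => F (κ * τ)) F (fun κ => rfl)).symm
  have hflip : ∀ κ : K, F (κ * τ) = - F κ := by
    intro κ
    have hcoe : ((κ * τ : K) : Equiv.Perm (Fin n)) = (κ : Equiv.Perm (Fin n)) * Equiv.swap (a i) (b i) := rfl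
    have hcomp : (⇑(g₀ * ((κ : Equiv.Perm (Fin n)) * Equiv.swap (a i) (b i))) ∘ p : Fin k → Fin n)
        = ⇑(g₀ * (κ : Equiv.Perm (Fin n))) ∘ p := by
      funext t
      simp [Equiv.swap_apply_of_ne_of_ne (hpa t) (hpb t)]
    have hsign : ((Equiv.Perm.sign (g₀ * ((κ : Equiv.Perm (Fin n)) * Equiv.swap (a i) (b i))) : ℤ) : ℂ)
        = - ((Equiv.Perm.sign (g₀ * (κ : Equiv.Perm (Fin n))) : ℤ) : ℂ) := by
      rw [← mul_assoc, Equiv.Perm.sign_mul, Equiv.Perm.sign_swap haibi]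
      push_cast; ring
    simp only [hF, hcoe]
    rw [hcomp, hsign, neg_mul]
  have hS : ∑ κ, F κ = - ∑ κ, F κ := by
    conv_lhs => rw [hreindex]
    rw [← Finset.sum_neg_distrib]
    exact Finset.sum_congr rfl fun κ _ => hflip κ
  have h0 : ∑ κ, F κ = 0 := by
    have h2 : (2 : ℂ) * ∑ κ, F κ = 0 := by rw [two_mul]; nth_rewrite 1 [hS]; ring
    exact (mul_eq_zero.mp h2).resolve_left two_ne_zero
  simpa [hF] using h0

/-- **Coset obstruction.** A `k`-token separated triple has, through every target point
`x₀⁻¹z₀` and for every `K = ⟨k+1 disjoint transpositions⟩`, a point `x₀⁻¹ z₀ κ`, `κ ∈ K`, outside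
the quotient set `X⁻¹ Y Y⁻¹ Z`. -/
theorem exists_coset_point_not_mem_quot {n k : ℕ} {X Y Z : Finset (Equiv.Perm (Fin n))}
    (h : Sep n k X Y Z) (a b : Fin (k + 1) → Fin n)
    (ha : Function.Injective a) (hb : Function.Injective b) (hab : ∀ i j, a i ≠ b j)
    {x₀ : Equiv.Perm (Fin n)} (hx₀ : x₀ ∈ X) {z₀ : Equiv.Perm (Fin n)} (hz₀ : z₀ ∈ Z) :
    ∃ κ ∈ Subgroup.closure (Set.range fun i => Equiv.swap (a i) (b i)),
      ∀ x ∈ X, ∀ y ∈ Y, ∀ y' ∈ Y, ∀ z ∈ Z, x⁻¹ * y * y'⁻¹ * z ≠ x₀⁻¹ * z₀ * κ := by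
  classical
  set K := Subgroup.closure (Set.range fun i => Equiv.swap (a i) (b i)) with hK
  by_contra hall
  push Not at hall
  obtain ⟨c, hc⟩ := h x₀ hx₀ z₀ hz₀
  -- on the coset the separator is the indicator of `κ = 1`
  have hf : ∀ κ : K, tokenFn c (x₀⁻¹ * z₀ * (κ : Equiv.Perm (Fin n))) = if κ = 1 then 1 else 0 := by
    intro κ
    obtain ⟨x, hx, y, hy, y', hy', z, hz, hg⟩ := hall κ κ.2
    have hval := hc x hx y hy y' hy' z hz
    change tokenFn c (x⁻¹ * y * y'⁻¹ * z) = _ at hval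
    rw [hg] at hval
    rw [hval]
    by_cases hcond : x = x₀ ∧ y = y' ∧ z = z₀
    · obtain ⟨rfl, rfl, rfl⟩ := hcond
      have hκ : (κ : Equiv.Perm (Fin n)) = 1 := by
        have : x⁻¹ * y * y⁻¹ * z = x⁻¹ * z := by group
        rw [this] at hg
        exact mul_left_cancel (a := x⁻¹ * z) (by rw [mul_one]; exact hg.symm)
      rw [if_pos ⟨rfl, rfl, rfl⟩, if_pos (Subtype.ext hκ)]
    · rw [if_neg hcond]
      by_cases hκ : κ = 1
      · -- the target quadruple `(x₀, y, y, z₀)` also produces this point, with value 1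
        have hval' := hc x₀ hx₀ y hy y hy z₀ hz₀
        change tokenFn c (x₀⁻¹ * y * y⁻¹ * z₀) = _ at hval'
        rw [if_pos ⟨rfl, rfl, rfl⟩] at hval'
        have : x₀⁻¹ * y * y⁻¹ * z₀ = x₀⁻¹ * z₀ * (κ : Equiv.Perm (Fin n)) := by
          rw [hκ, Subgroup.coe_one, mul_one]; group
        rw [this, hval, if_neg hcond] at hval'
        exact absurd hval' zero_ne_one
      · rw [if_neg hκ]
  have hsum := sum_coset_sign_mul_tokenFn a b ha hb hab c (x₀⁻¹ * z₀)
  simp_rw [hf, mul_ite, mul_one, mul_zero, Finset.sum_ite_eq', Finset.mem_univ, if_true] at hsum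
  have hunit : ((Equiv.Perm.sign (x₀⁻¹ * z₀ * ((1 : K) : Equiv.Perm (Fin n))) : ℤ) : ℂ) ≠ 0 := by
    rcases Int.units_eq_one_or (Equiv.Perm.sign (x₀⁻¹ * z₀ * ((1 : K) : Equiv.Perm (Fin n)))) with h1 | h1 <;>
      (rw [h1]; simp)
  exact hunit hsum

end

end Summit.MatrixMultiplication.MatrixMultiplication.Theorems.SnLevelDesigns.Negative
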